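import Literature.MathematicalPhysics.QuantumLattice.HubbardWave0RepulsiveProofs
import Literature.MathematicalPhysics.QuantumLattice.HubbardRingPerronFrobeniusProofs
import Literature.MathematicalPhysics.QuantumLattice.HubbardSzSectorLadder
import Literature.MathematicalPhysics.QuantumLattice.GroundStateEnclosureCertificate
import HarnessLib

/-!
# The half-filled repulsive Hubbard model on a balanced bipartite graph: THE ground state

Family `hubbard` (trunk T-QLATTICE), written for the certified-numerics cell `pub-mbboot`
(correlator enclosures "in the ground state at half filling").

Lieb's second theorem (E. H. Lieb, *Two theorems on the Hubbard model*, PRL **62** (1989) 1201,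
Theorem 2) is a tree theorem: `lieb_repulsive_halfFilling_holds` (file
`HubbardWave0RepulsiveProofs`). This file specialises it to the balanced case `|A| = |B|`
(`S = 0`) and turns it into the statements a sector certificate needs in order to speak about
THE ground state of the `N = |Λ|`-particle Hubbard Hamiltonian rather than about the lowest state
of the coordinate sector `(N↑, N↓) = (n, n)`, `|Λ| = 2n`:

* `LiebHalfFilled.finrank_groundSector_eq_one` — the ground eigenspace of the `N = |Λ|` sector
  (`(hamiltonian G t U).sectorGroundSpace (nParticleSubmodule |Λ|)`) is one-dimensional, and
  `spinSq ψ = 0` on it; `groundState_unique` — two half-filled ground states are proportional;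
* `LiebHalfFilled.groundSector_le_szSector` — it lies inside the central sector
  `szSector |Λ| 0` (`N↑ = N↓ = n`), hence (`sectorGroundSpace_szSector_eq`,
  `sectorGroundProj_szSector_eq`) the sector ground multiplet / projection of the central sector
  IS the `N`-particle ground multiplet / projection, and the tracial `N`-particle ground state is
  the vector state of a unit ground-state vector (`exists_unit_groundState`);
* `LiebHalfFilled.groundEnergyAt_lt_minEnergyOn_szSector_one` — the spin gap is positive:
  `E₀(|Λ|) < λ_min(N↑ = n + 1, N↓ = n - 1)`;
* `LiebHalfFilled.groundState_expectation_certificate` — the Kato–Temple + mixing certificate of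
  `TempleKato.sector_expectation_enclosure`, run in the central sector, bounds the expectation of
  an observable in THE half-filled ground state.

Hypotheses throughout (Lieb's): `G` connected, bipartite with colour class `A` and
`|Aᶜ| = |A|`, hopping `t ≠ 0`, `U > 0`.

## What is NOT claimed

Away from half filling, for `U < 0`, on non-bipartite graphs or with `|A| ≠ |B|` nothing here
applies (for `|A| ≠ |B|` the ground state has spin `(|B| - |A|)/2 > 0` and is degenerate). A
purely computational substitute — no bipartiteness, any `t`, `U`, any even `N = 2n` — is the
namespace `SpinGapCertificate` below: if no ground-energy eigenvector has `S^z = ±1` (certified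
by form bounds `Re ⟨φ, H φ⟩ ≥ σ± ‖φ‖²` on the sectors `S^z = ±1` with `σ± > E₀(2n)`), the
`2n`-particle ground multiplet lies in `S^z = 0` (`groundSector_le_szSector_of_noWeightOne`,
`_of_spinGap`, `_of_form_bounds`; `su(2)` ladder), and together with a Kato–Temple certificate in
the central sector this again identifies THE ground state (`SpinGapCertificate.groundState_certificate`).

## References

* E. H. Lieb, *Two theorems on the Hubbard model*, Phys. Rev. Lett. 62 (1989) 1201–1204; Erratum
  62 (1989) 1927 — Theorem 2 (reprint read: A. Montorsi (ed.), *The Hubbard Model*, World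
  Scientific, pp. 111–119, `book:editornd-hubbard-model`). [LiebPRL1989]
* H. Tasaki, *Physics and Mathematics of Quantum Many-Body Systems* (2020), §2.1–2.2 (sector
  ground states), §10.2 (Lieb's theorem). [Tasaki2020]
-/

noncomputable section

namespace Literature.MathematicalPhysics.QuantumLattice

open Matrix Finset
open scoped ComplexOrder

namespace LiebHalfFilled

variable {Λ : Type*} [LinearOrder Λ] [Fintype Λ] (G : SimpleGraph Λ) [DecidableRel G.Adj]

/-! ### Sector bookkeeping valid for every `t`, `U` -/

/-- The Hubbard Hamiltonian maps each joint sector `(N, S^z = M)` into itself (it commutes with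
`N` and `S^z`). Lieb, PRL 62 (1989) 1201, §2. [folklore] -/
theorem hamiltonian_mulVec_mem_szSector (t U : ℝ) {N : ℕ} {M : ℝ} {v : Fock (Orb Λ)}
    (hv : v ∈ szSector N M) : hamiltonian G t U *ᵥ v ∈ szSector N M := by
  rw [mem_szSector_iff] at hv ⊢
  obtain ⟨-, hN, hZ⟩ := hamiltonian_isHermitian_and_commute_holds G t U
  refine ⟨LiebTwo.isNParticle_mulVec_of_commute hv.1 hN.eq.symm, ?_⟩
  rw [mulVec_mulVec, ← hZ.eq, ← mulVec_mulVec, hv.2, mulVec_smul]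

/-- The Hubbard Hamiltonian maps the `N`-particle sector into itself. [folklore] -/
theorem hamiltonian_mulVec_mem_nParticleSubmodule (t U : ℝ) {N : ℕ} {v : Fock (Orb Λ)}
    (hv : v ∈ nParticleSubmodule (ι := Orb Λ) N) :
    hamiltonian G t U *ᵥ v ∈ nParticleSubmodule (ι := Orb Λ) N := by
  rw [mem_nParticleSubmodule_iff] at hv ⊢
  obtain ⟨-, hN, -⟩ := hamiltonian_isHermitian_and_commute_holds G t U
  exact LiebTwo.isNParticle_mulVec_of_commute hv hN.eq.symm

/-- The sector ground multiplet of the `N`-particle sector (`Matrix.sectorGroundSpace` of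
`nParticleSubmodule N`) is the ground eigenspace `ker (H - E₀(N)) ∩ ker (N̂ - N)` appearing in
`lieb_repulsive_halfFilling`. [folklore] -/
theorem sectorGroundSpace_nParticle_eq (t U : ℝ) (N : ℕ) :
    (hamiltonian G t U).sectorGroundSpace (nParticleSubmodule (ι := Orb Λ) N) =
      LinearMap.ker (Matrix.toLin' (hamiltonian G t U -
          ((groundEnergy (hamiltonian G t U) N : ℝ) : ℂ) • 1)) ⊓
        LinearMap.ker (Matrix.toLin' (totalNumber - (N : ℂ) • (1 : Matrix _ _ ℂ))) := by
  ext ψ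
  rw [Matrix.mem_sectorGroundSpace_iff, LiebTwo.mem_groundSector_iff,
    ← groundEnergy_eq_minEnergyOn (hamiltonian G t U) N _ (fun _ => Iff.rfl),
    mem_nParticleSubmodule_iff]
  exact ⟨fun h => ⟨h.2, h.1⟩, fun h => ⟨h.2, h.1⟩⟩

/-- Membership in the `N`-particle ground multiplet: `ψ` is an `N`-particle vector with
`H ψ = E₀(N) ψ` (`E₀(N) = groundEnergyAt G t U N`). [folklore] -/
theorem mem_groundSector_iff (t U : ℝ) (N : ℕ) (ψ : Fock (Orb Λ)) :
    ψ ∈ (hamiltonian G t U).sectorGroundSpace (nParticleSubmodule (ι := Orb Λ) N) ↔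
      IsNParticle N ψ ∧ hamiltonian G t U *ᵥ ψ = ((groundEnergyAt G t U N : ℝ) : ℂ) • ψ := by
  rw [Matrix.mem_sectorGroundSpace_iff,
    ← groundEnergy_eq_minEnergyOn (hamiltonian G t U) N _ (fun _ => Iff.rfl),
    mem_nParticleSubmodule_iff]
  rfl

/-- A nonzero member of the `N`-particle ground multiplet is a ground state in the sense of
`IsGroundState`, and conversely. [folklore] -/
theorem isGroundState_iff (t U : ℝ) (N : ℕ) (ψ : Fock (Orb Λ)) :
    IsGroundState (hamiltonian G t U) N ψ ↔
      ψ ≠ 0 ∧ ψ ∈ (hamiltonian G t U).sectorGroundSpace (nParticleSubmodule (ι := Orb Λ) N) := by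
  rw [mem_groundSector_iff, IsGroundState]
  exact ⟨fun h => ⟨h.2.1, h.1, h.2.2⟩, fun h => ⟨h.2.1, h.1, h.2.2⟩⟩

/-- The central sector's ground multiplet is contained in the `2n`-particle ground multiplet,
for every `t`, `U` (since `E₀(2n) = λ_min(n, n)`, `groundEnergyAt_eq_minEnergyOn_szSector`).
Lieb, PRL 62 (1989) 1201, proof of Theorem 1. [folklore] -/
theorem sectorGroundSpace_szSector_le (t U : ℝ) {n : ℕ} (hn : n ≤ Fintype.card Λ) :
    (hamiltonian G t U).sectorGroundSpace (szSector (2 * n) 0) ≤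
      (hamiltonian G t U).sectorGroundSpace (nParticleSubmodule (ι := Orb Λ) (2 * n)) := by
  intro ψ hψ
  rw [Matrix.mem_sectorGroundSpace_iff, ← groundEnergyAt_eq_minEnergyOn_szSector G t U hn] at hψ
  rw [mem_groundSector_iff]
  exact ⟨((mem_szSector_iff _ _ _).1 hψ.1).1, hψ.2⟩

/-! ### Lieb's theorem at `|A| = |B|`: a unique singlet ground state -/

variable {G}

/-- **Lieb's Theorem 2 at `|A| = |B|`.** For `G` connected and bipartite with colour class `A`,
`|Aᶜ| = |A|`, `t ≠ 0` and `U > 0`, the ground eigenspace of the Hubbard Hamiltonian in the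
half-filled sector `N = |Λ|` is one-dimensional, and its vectors are singlets (`S² ψ = 0`).
Specialisation of the tree theorem `lieb_repulsive_halfFilling_holds` (`2S + 1 = 1`).
Lieb, PRL 62 (1989) 1201, Theorem 2. [cite: LiebPRL1989, Theorem 2] -/
theorem finrank_groundSector_eq_one (hG : G.Connected) (A : Finset Λ)
    (hA : ∀ x y : Λ, G.Adj x y → (x ∈ A ↔ y ∉ A)) (hcard : Aᶜ.card = A.card)
    {t U : ℝ} (ht : t ≠ 0) (hU : 0 < U) :
    Module.finrank ℂ
        ((hamiltonian G t U).sectorGroundSpace (nParticleSubmodule (ι := Orb Λ) (Fintype.card Λ))) = 1 ∧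
      ∀ ψ ∈ (hamiltonian G t U).sectorGroundSpace (nParticleSubmodule (ι := Orb Λ) (Fintype.card Λ)),
        spinSq *ᵥ ψ = 0 := by
  have hΛ : Even (Fintype.card Λ) := ⟨A.card, by rw [← Finset.card_add_card_compl A, hcard]⟩
  have hS : liebSpin A = 0 := by simp [liebSpin, hcard]
  obtain ⟨hspin, hrank⟩ := lieb_repulsive_halfFilling_holds G hG A hA hΛ t U ht hU _ rfl
  rw [hS] at hspin hrank
  rw [sectorGroundSpace_nParticle_eq]
  refine ⟨?_, fun ψ hψ => ?_⟩
  · rw [mul_zero, zero_add] at hrank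
    exact_mod_cast hrank
  · by_cases h0 : ψ = 0
    · rw [h0, mulVec_zero]
    · have hgs : IsGroundState (hamiltonian G t U) (Fintype.card Λ) ψ := by
        rw [isGroundState_iff, sectorGroundSpace_nParticle_eq]
        exact ⟨h0, hψ⟩
      have h := hspin ψ hgs
      rw [h, zero_add, mul_one, Complex.ofReal_zero, zero_smul]

/-- **Uniqueness up to scalars** (the shape of `lieb_attractive`'s first conclusion): two
half-filled ground states are proportional. Lieb, PRL 62 (1989) 1201, Theorem 2.
[cite: LiebPRL1989, Theorem 2] -/
theorem groundState_unique (hG : G.Connected) (A : Finset Λ)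
    (hA : ∀ x y : Λ, G.Adj x y → (x ∈ A ↔ y ∉ A)) (hcard : Aᶜ.card = A.card)
    {t U : ℝ} (ht : t ≠ 0) (hU : 0 < U) {ψ φ : Fock (Orb Λ)}
    (hψ : IsGroundState (hamiltonian G t U) (Fintype.card Λ) ψ)
    (hφ : IsGroundState (hamiltonian G t U) (Fintype.card Λ) φ) : ∃ a : ℂ, φ = a • ψ := by
  obtain ⟨hfin, -⟩ := finrank_groundSector_eq_one hG A hA hcard ht hU
  rw [isGroundState_iff] at hψ hφ
  set V := (hamiltonian G t U).sectorGroundSpace (nParticleSubmodule (ι := Orb Λ) (Fintype.card Λ))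
  have hne : (⟨ψ, hψ.2⟩ : V) ≠ 0 := fun h => hψ.1 (by simpa using congrArg Subtype.val h)
  obtain ⟨a, ha⟩ := (finrank_eq_one_iff_of_nonzero' _ hne).1 hfin ⟨φ, hφ.2⟩
  exact ⟨a, by simpa using (congrArg Subtype.val ha).symm⟩

/-- **The half-filled ground state lives in the central sector `N↑ = N↓`.** Under Lieb's
hypotheses with `|Aᶜ| = |A|`, the `|Λ|`-particle ground multiplet is contained in
`szSector |Λ| 0`. (The central sector contains a ground state for every `t`, `U`
(`szSector_groundState`); by one-dimensionality it contains all of them.)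
Lieb, PRL 62 (1989) 1201, Theorem 2. [cite: LiebPRL1989, Theorem 2] -/
theorem groundSector_le_szSector (hG : G.Connected) (A : Finset Λ)
    (hA : ∀ x y : Λ, G.Adj x y → (x ∈ A ↔ y ∉ A)) (hcard : Aᶜ.card = A.card)
    {t U : ℝ} (ht : t ≠ 0) (hU : 0 < U) :
    (hamiltonian G t U).sectorGroundSpace (nParticleSubmodule (ι := Orb Λ) (Fintype.card Λ)) ≤
      szSector (Fintype.card Λ) 0 := by
  obtain ⟨hfin, -⟩ := finrank_groundSector_eq_one hG A hA hcard ht hU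
  have hΛ : Fintype.card Λ = 2 * A.card := by rw [← Finset.card_add_card_compl A, hcard, two_mul]
  have hn : A.card ≤ Fintype.card Λ := by rw [hΛ]; omega
  set V := (hamiltonian G t U).sectorGroundSpace (nParticleSubmodule (ι := Orb Λ) (Fintype.card Λ))
    with hV
  -- a ground state in the central sector
  obtain ⟨⟨ψ₁, hψ₁K, hψ₁0, hHψ₁⟩, -⟩ := szSector_groundState G t U hn
  rw [← hΛ] at hψ₁K hHψ₁
  have hψ₁V : ψ₁ ∈ V := by
    have h := sectorGroundSpace_szSector_le G t U hn
    rw [← hΛ] at h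
    exact h ((Matrix.mem_sectorGroundSpace_iff _ _ _).2 ⟨hψ₁K, hHψ₁⟩)
  have hne : (⟨ψ₁, hψ₁V⟩ : V) ≠ 0 := fun h => hψ₁0 (by simpa using congrArg Subtype.val h)
  intro φ hφ
  obtain ⟨a, ha⟩ := (finrank_eq_one_iff_of_nonzero' _ hne).1 hfin ⟨φ, hφ⟩
  have hφeq : φ = a • ψ₁ := by simpa using (congrArg Subtype.val ha).symm
  rw [hφeq]
  exact Submodule.smul_mem _ a hψ₁K

/-- **The central sector's ground multiplet IS the half-filled ground multiplet.**
Lieb, PRL 62 (1989) 1201, Theorem 2. [cite: LiebPRL1989, Theorem 2] -/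
theorem sectorGroundSpace_szSector_eq (hG : G.Connected) (A : Finset Λ)
    (hA : ∀ x y : Λ, G.Adj x y → (x ∈ A ↔ y ∉ A)) (hcard : Aᶜ.card = A.card)
    {t U : ℝ} (ht : t ≠ 0) (hU : 0 < U) :
    (hamiltonian G t U).sectorGroundSpace (szSector (Fintype.card Λ) 0) =
      (hamiltonian G t U).sectorGroundSpace (nParticleSubmodule (ι := Orb Λ) (Fintype.card Λ)) := by
  have hΛ : Fintype.card Λ = 2 * A.card := by rw [← Finset.card_add_card_compl A, hcard, two_mul]
  have hn : A.card ≤ Fintype.card Λ := by rw [hΛ]; omega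
  refine le_antisymm ?_ fun φ hφ => ?_
  · have h := sectorGroundSpace_szSector_le G t U hn
    rwa [← hΛ] at h
  · rw [Matrix.mem_sectorGroundSpace_iff]
    refine ⟨groundSector_le_szSector hG A hA hcard ht hU hφ, ?_⟩
    have hE : groundEnergyAt G t U (Fintype.card Λ) =
        (hamiltonian G t U).minEnergyOn (szSector (Fintype.card Λ) 0) := by
      rw [hΛ]; exact groundEnergyAt_eq_minEnergyOn_szSector G t U hn
    rw [← hE]
    exact ((mem_groundSector_iff G t U _ φ).1 hφ).2

/-- **The central sector's ground projection IS the half-filled ground projection** (so the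
tracial sector ground state `projState (sectorGroundProj H (szSector |Λ| 0))` of the certificate
files is the tracial ground state of the `|Λ|`-particle Hubbard Hamiltonian).
Lieb, PRL 62 (1989) 1201, Theorem 2. [cite: LiebPRL1989, Theorem 2] -/
theorem sectorGroundProj_szSector_eq (hG : G.Connected) (A : Finset Λ)
    (hA : ∀ x y : Λ, G.Adj x y → (x ∈ A ↔ y ∉ A)) (hcard : Aᶜ.card = A.card)
    {t U : ℝ} (ht : t ≠ 0) (hU : 0 < U) :
    (hamiltonian G t U).sectorGroundProj (szSector (Fintype.card Λ) 0) =
      (hamiltonian G t U).sectorGroundProj (nParticleSubmodule (ι := Orb Λ) (Fintype.card Λ)) := by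
  unfold Matrix.sectorGroundProj
  rw [sectorGroundSpace_szSector_eq hG A hA hcard ht hU]

/-- **THE half-filled ground state.** Under Lieb's hypotheses with `|Aᶜ| = |A|` there is a unit
vector `ψ` in the central sector with `H ψ = E₀(|Λ|) ψ` and `S² ψ = 0`, every half-filled ground
state is `⟨ψ, φ⟩ ψ`, the half-filled ground multiplet is one-dimensional, and the tracial
`|Λ|`-particle ground state is the vector state `O ↦ ⟨ψ, O ψ⟩`.
Lieb, PRL 62 (1989) 1201, Theorem 2; Tasaki (2020) §2.1. [cite: LiebPRL1989, Theorem 2] -/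
theorem exists_unit_groundState (hG : G.Connected) (A : Finset Λ)
    (hA : ∀ x y : Λ, G.Adj x y → (x ∈ A ↔ y ∉ A)) (hcard : Aᶜ.card = A.card)
    {t U : ℝ} (ht : t ≠ 0) (hU : 0 < U) :
    ∃ ψ ∈ szSector (Fintype.card Λ) 0, star ψ ⬝ᵥ ψ = 1 ∧
      hamiltonian G t U *ᵥ ψ = ((groundEnergyAt G t U (Fintype.card Λ) : ℝ) : ℂ) • ψ ∧
      spinSq *ᵥ ψ = 0 ∧
      (∀ φ : Fock (Orb Λ), IsNParticle (Fintype.card Λ) φ →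
        hamiltonian G t U *ᵥ φ = ((groundEnergyAt G t U (Fintype.card Λ) : ℝ) : ℂ) • φ →
          φ = (star ψ ⬝ᵥ φ) • ψ) ∧
      ∀ O : Matrix (Finset (Orb Λ)) (Finset (Orb Λ)) ℂ,
        ((hamiltonian G t U).sectorGroundProj (nParticleSubmodule (ι := Orb Λ) (Fintype.card Λ))).projState O =
          star ψ ⬝ᵥ O *ᵥ ψ := by
  obtain ⟨hfin, hspin⟩ := finrank_groundSector_eq_one hG A hA hcard ht hU
  set H := hamiltonian G t U with hH
  set N := Fintype.card Λ with hN
  set K : Submodule ℂ (Fock (Orb Λ)) := nParticleSubmodule (ι := Orb Λ) N with hK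
  set V := H.sectorGroundSpace K with hV
  have hHerm : H.IsHermitian := LiebThm1.hamiltonian_isHermitian G t U
  -- `V ≠ ⊥`, so the sector energy is attained at a unit eigenvector
  have hVne : V ≠ ⊥ := by
    intro h
    rw [h, finrank_bot] at hfin
    exact zero_ne_one hfin
  have hKne : K ≠ ⊥ := by
    intro h
    apply hVne
    rw [eq_bot_iff]
    intro v hv
    rw [← h]
    exact ((Matrix.mem_sectorGroundSpace_iff _ _ _).1 hv).1
  obtain ⟨ψ, hψK, hψ1, hHψ⟩ :=
    exists_unit_eigen_minEnergyOn hHerm K (fun v hv => hamiltonian_mulVec_mem_nParticleSubmodule G t U hv) hKne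
  have hE : groundEnergyAt G t U N = H.minEnergyOn K :=
    groundEnergy_eq_minEnergyOn H N K (fun _ => Iff.rfl)
  have hψV : ψ ∈ V := (Matrix.mem_sectorGroundSpace_iff _ _ _).2 ⟨hψK, hHψ⟩
  have hψ0 : ψ ≠ 0 := by
    rintro rfl
    rw [dotProduct_zero] at hψ1
    exact zero_ne_one hψ1
  have hne : (⟨ψ, hψV⟩ : V) ≠ 0 := fun h => hψ0 (by simpa using congrArg Subtype.val h)
  have huniq : ∀ φ ∈ K, H *ᵥ φ = ((H.minEnergyOn K : ℝ) : ℂ) • φ → φ = (star ψ ⬝ᵥ φ) • ψ := by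
    intro φ hφK hHφ
    have hφV : φ ∈ V := (Matrix.mem_sectorGroundSpace_iff _ _ _).2 ⟨hφK, hHφ⟩
    obtain ⟨a, ha⟩ := (finrank_eq_one_iff_of_nonzero' _ hne).1 hfin ⟨φ, hφV⟩
    have hφeq : φ = a • ψ := by simpa using (congrArg Subtype.val ha).symm
    rw [hφeq, dotProduct_smul, hψ1, smul_eq_mul, mul_one]
  obtain ⟨-, hstate⟩ := TempleKato.projState_sectorGroundProj_eq K hψK hψ1 hHψ huniq
  refine ⟨ψ, groundSector_le_szSector hG A hA hcard ht hU hψV, hψ1, ?_, hspin ψ hψV, ?_, hstate⟩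
  · rw [hE]; exact hHψ
  · intro φ hφN hHφ
    rw [hE] at hHφ
    exact huniq φ hφN hHφ

/-! ### The spin gap is positive -/

/-- The sector `(N↑, N↓) = (m + 2, m)` is the joint sector `(2(m+1), S^z = 1)` and is non-trivial
when `m + 2 ≤ |Λ|`. [folklore] -/
theorem szSector_one_ne_bot {m : ℕ} (hm : m + 2 ≤ Fintype.card Λ) :
    (szSector (2 * (m + 1)) 1 : Submodule ℂ (Fock (Orb Λ))) ≠ ⊥ := by
  classical
  obtain ⟨α, -, hα⟩ : ∃ α : Finset Λ, α ⊆ univ ∧ α.card = m + 2 :=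
    Finset.exists_subset_card_eq (by rwa [Finset.card_univ])
  obtain ⟨β, -, hβ⟩ : ∃ β : Finset Λ, β ⊆ univ ∧ β.card = m :=
    Finset.exists_subset_card_eq (by rw [Finset.card_univ]; omega)
  set φ₀ : Fock (Orb Λ) := Pi.single (pairSet α β) 1 with hφ₀
  have hsec : IsInSector (m + 2) m φ₀ := by
    intro s hs
    rw [hφ₀, Pi.single_apply, if_neg]
    rintro rfl
    exact hs ⟨by rw [upPart_pairSet, hα], by rw [downPart_pairSet, hβ]⟩
  have hmem : φ₀ ∈ szSector ((m + 2) + m) ((((m + 2 : ℕ) : ℝ) - m) / 2) :=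
    (mem_szSector_iff_isInSector (m + 2) m φ₀).2 hsec
  have h1 : ((((m + 2 : ℕ) : ℝ) - m) / 2) = 1 := by push_cast; ring
  have h2 : (m + 2) + m = 2 * (m + 1) := by ring
  rw [h1, h2] at hmem
  intro hbot
  rw [hbot, Submodule.mem_bot] at hmem
  have h := congrFun hmem (pairSet α β)
  rw [hφ₀, Pi.single_eq_same] at h
  exact one_ne_zero h

/-- **Positive spin gap at half filling.** Under Lieb's hypotheses with `|Aᶜ| = |A| ≥ 1`
(`|Λ| = 2n`), the lowest energy of the sector `(N↑, N↓) = (n + 1, n - 1)` (`szSector |Λ| 1`; it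
contains a member of every multiplet of spin `S ≥ 1`) is STRICTLY above the half-filled
ground-state energy: the unique ground state is a singlet and lies in `S^z = 0`.
Lieb, PRL 62 (1989) 1201, Theorem 2. [cite: LiebPRL1989, Theorem 2] -/
theorem groundEnergyAt_lt_minEnergyOn_szSector_one (hG : G.Connected) (A : Finset Λ)
    (hA : ∀ x y : Λ, G.Adj x y → (x ∈ A ↔ y ∉ A)) (hcard : Aᶜ.card = A.card) (hA0 : A.Nonempty)
    {t U : ℝ} (ht : t ≠ 0) (hU : 0 < U) :
    groundEnergyAt G t U (Fintype.card Λ) <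
      (hamiltonian G t U).minEnergyOn (szSector (Fintype.card Λ) 1) := by
  set H := hamiltonian G t U with hH
  set N := Fintype.card Λ with hN
  have hΛ : N = 2 * A.card := by rw [hN, ← Finset.card_add_card_compl A, hcard, two_mul]
  obtain ⟨m, hm⟩ : ∃ m, A.card = m + 1 := Nat.exists_eq_add_one.2 hA0.card_pos
  have hHerm : H.IsHermitian := LiebThm1.hamiltonian_isHermitian G t U
  set K₁ : Submodule ℂ (Fock (Orb Λ)) := szSector N 1 with hK₁
  have hK₁ne : K₁ ≠ ⊥ := by
    rw [hK₁, hΛ, hm]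
    exact szSector_one_ne_bot (by rw [← hN, hΛ, hm]; omega)
  obtain ⟨u, huK, hu1, hHu⟩ :=
    exists_unit_eigen_minEnergyOn hHerm K₁ (fun v hv => hamiltonian_mulVec_mem_szSector G t U hv) hK₁ne
  obtain ⟨huN, huZ⟩ := (mem_szSector_iff _ _ _).1 huK
  -- variational principle in the `N`-particle sector: `E₀ ≤ e₁`
  have hE : groundEnergyAt G t U N = H.minEnergyOn (nParticleSubmodule (ι := Orb Λ) N) :=
    groundEnergy_eq_minEnergyOn H N _ (fun _ => Iff.rfl)
  have hle : groundEnergyAt G t U N ≤ H.minEnergyOn K₁ := by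
    have h := minEnergyOn_mul_le_re_rayleigh hHerm (nParticleSubmodule (ι := Orb Λ) N)
      ((mem_nParticleSubmodule_iff N u).2 huN)
    rw [hu1, Complex.one_re, mul_one, hHu, dotProduct_smul, hu1, smul_eq_mul, mul_one,
      Complex.ofReal_re, ← hE] at h
    exact h
  refine lt_of_le_of_ne hle fun heq => ?_
  -- if `E₀ = e₁` the weight-one eigenvector `u` would be a ground state, hence in `S^z = 0`
  have huV : u ∈ H.sectorGroundSpace (nParticleSubmodule (ι := Orb Λ) N) := by
    rw [mem_groundSector_iff, heq]
    exact ⟨huN, hHu⟩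
  have hu0 : u ∈ szSector N 0 := groundSector_le_szSector hG A hA hcard ht hU huV
  obtain ⟨-, huZ0⟩ := (mem_szSector_iff _ _ _).1 hu0
  rw [huZ0, Complex.ofReal_zero, zero_smul, Complex.ofReal_one, one_smul] at huZ
  rw [← huZ, dotProduct_zero] at hu1
  exact zero_ne_one hu1

/-! ### Certificates in the central sector speak about THE ground state -/

/-- **Kato–Temple certificate in the central sector ⇒ enclosure of THE half-filled ground state.**
Under Lieb's hypotheses with `|Aᶜ| = |A|`, a gap certificate `(W, u)` with threshold `σ` for the
central sector `K = szSector |Λ| 0` (`Re ⟨z, H z⟩ ≥ σ ‖z‖²` on `W`, `K ≤ W + ℂ u`; produced by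
`TempleKato.exists_codimOne_of_*_certificate`) and a unit trial vector `w ∈ K` with
`Re ⟨w, H w⟩ = ρ < σ`, `‖H w‖² ≤ r² + ρ²` give: `ρ - r²/(σ - ρ) ≤ E₀(|Λ|) ≤ ρ`, and THE
half-filled ground state `ψ` (unit, unique up to phase, every `|Λ|`-particle ground state is
`⟨ψ, φ⟩ ψ`, the tracial `|Λ|`-particle ground state is `O ↦ ⟨ψ, O ψ⟩`) satisfies
`(1 - |⟨ψ, w⟩|²)(σ - ρ)² ≤ r²`. Kato (1949) / Temple (1928) via Saad (1992) Thms 3.8–3.9;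
Lieb (1989) Thm 2. [cite: LiebPRL1989, Theorem 2] -/
theorem groundState_certificate (hG : G.Connected) (A : Finset Λ)
    (hA : ∀ x y : Λ, G.Adj x y → (x ∈ A ↔ y ∉ A)) (hcard : Aᶜ.card = A.card)
    {t U : ℝ} (ht : t ≠ 0) (hU : 0 < U)
    {W : Submodule ℂ (Fock (Orb Λ))} {u : Fock (Orb Λ)} {σ : ℝ}
    (hW : ∀ z ∈ W, σ * (star z ⬝ᵥ z).re ≤ (star z ⬝ᵥ hamiltonian G t U *ᵥ z).re)
    (hWK : ∀ x ∈ szSector (Fintype.card Λ) 0, ∃ z ∈ W, ∃ c : ℂ, x = z + c • u)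
    {w : Fock (Orb Λ)} (hwK : w ∈ szSector (Fintype.card Λ) 0) (hw1 : star w ⬝ᵥ w = 1)
    {ρ r2 : ℝ} (hρ : (star w ⬝ᵥ hamiltonian G t U *ᵥ w).re = ρ)
    (hr2 : (star (hamiltonian G t U *ᵥ w) ⬝ᵥ hamiltonian G t U *ᵥ w).re ≤ r2 + ρ ^ 2)
    (hρσ : ρ < σ) :
    ρ - r2 / (σ - ρ) ≤ groundEnergyAt G t U (Fintype.card Λ) ∧
      groundEnergyAt G t U (Fintype.card Λ) ≤ ρ ∧
      ∃ ψ ∈ szSector (Fintype.card Λ) 0, star ψ ⬝ᵥ ψ = 1 ∧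
        hamiltonian G t U *ᵥ ψ = ((groundEnergyAt G t U (Fintype.card Λ) : ℝ) : ℂ) • ψ ∧
        (∀ φ : Fock (Orb Λ), IsNParticle (Fintype.card Λ) φ →
          hamiltonian G t U *ᵥ φ = ((groundEnergyAt G t U (Fintype.card Λ) : ℝ) : ℂ) • φ →
            φ = (star ψ ⬝ᵥ φ) • ψ) ∧
        (∀ O : Matrix (Finset (Orb Λ)) (Finset (Orb Λ)) ℂ,
          ((hamiltonian G t U).sectorGroundProj
              (nParticleSubmodule (ι := Orb Λ) (Fintype.card Λ))).projState O = star ψ ⬝ᵥ O *ᵥ ψ) ∧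
        (1 - ‖star ψ ⬝ᵥ w‖ ^ 2) * (σ - ρ) ^ 2 ≤ r2 := by
  set H := hamiltonian G t U with hH
  set N := Fintype.card Λ with hN
  have hΛ : N = 2 * A.card := by rw [hN, ← Finset.card_add_card_compl A, hcard, two_mul]
  have hn : A.card ≤ Fintype.card Λ := by rw [← hN, hΛ]; omega
  have hHerm : H.IsHermitian := LiebThm1.hamiltonian_isHermitian G t U
  have hE : groundEnergyAt G t U N = H.minEnergyOn (szSector N 0) := by
    rw [hΛ]; exact groundEnergyAt_eq_minEnergyOn_szSector G t U hn
  obtain ⟨h1, h2, ψ, hψK, hψ1, hHψ, huniq, -, hsin⟩ :=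
    TempleKato.sector_enclosure hHerm (szSector N 0)
      (fun v hv => hamiltonian_mulVec_mem_szSector G t U hv) hW hWK hwK hw1 hρ hr2 hρσ
  obtain ⟨-, hstate⟩ := TempleKato.projState_sectorGroundProj_eq (szSector N 0) hψK hψ1 hHψ huniq
  rw [← hE] at h1 h2 hHψ huniq
  rw [sectorGroundProj_szSector_eq hG A hA hcard ht hU] at hstate
  refine ⟨h1, h2, ψ, hψK, hψ1, hHψ, fun φ hφN hHφ => ?_, hstate, hsin⟩
  have hφV : φ ∈ H.sectorGroundSpace (nParticleSubmodule (ι := Orb Λ) N) :=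
    (mem_groundSector_iff G t U N φ).2 ⟨hφN, hHφ⟩
  exact huniq φ (groundSector_le_szSector hG A hA hcard ht hU hφV) hHφ

/-- **Certified interval for an expectation in THE half-filled ground state.** In the situation
of `groundState_certificate`, for an observable `O` with `|⟨x, (O - m) x⟩| ≤ h ‖x‖²` and `β ≥ 0`
with `r² ≤ β² (σ - ρ)²`: the tracial ground state `ω₀` of the `|Λ|`-particle Hubbard Hamiltonian
(`projState` of `sectorGroundProj H (nParticleSubmodule |Λ|)`, a pure state here) satisfies
`|Re ω₀(O) - Re ⟨w, O w⟩| ≤ 2 h (β + β²)`. This is `TempleKato.sector_expectation_enclosure` run in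
the central sector, plus Lieb's theorem identifying the central sector's ground state with THE
ground state. [cite: LiebPRL1989, Theorem 2] -/
theorem groundState_expectation_certificate (hG : G.Connected) (A : Finset Λ)
    (hA : ∀ x y : Λ, G.Adj x y → (x ∈ A ↔ y ∉ A)) (hcard : Aᶜ.card = A.card)
    {t U : ℝ} (ht : t ≠ 0) (hU : 0 < U)
    {W : Submodule ℂ (Fock (Orb Λ))} {u : Fock (Orb Λ)} {σ : ℝ}
    (hW : ∀ z ∈ W, σ * (star z ⬝ᵥ z).re ≤ (star z ⬝ᵥ hamiltonian G t U *ᵥ z).re)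
    (hWK : ∀ x ∈ szSector (Fintype.card Λ) 0, ∃ z ∈ W, ∃ c : ℂ, x = z + c • u)
    {w : Fock (Orb Λ)} (hwK : w ∈ szSector (Fintype.card Λ) 0) (hw1 : star w ⬝ᵥ w = 1)
    {ρ r2 : ℝ} (hρ : (star w ⬝ᵥ hamiltonian G t U *ᵥ w).re = ρ)
    (hr2 : (star (hamiltonian G t U *ᵥ w) ⬝ᵥ hamiltonian G t U *ᵥ w).re ≤ r2 + ρ ^ 2)
    (hρσ : ρ < σ) {O : Matrix (Finset (Orb Λ)) (Finset (Orb Λ)) ℂ} {m h β : ℝ}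
    (hOform : ∀ x : Fock (Orb Λ),
      ‖star x ⬝ᵥ O *ᵥ x - (m : ℂ) * (star x ⬝ᵥ x)‖ ≤ h * (star x ⬝ᵥ x).re)
    (hβ : 0 ≤ β) (hβr : r2 ≤ β ^ 2 * (σ - ρ) ^ 2) :
    |(((hamiltonian G t U).sectorGroundProj
          (nParticleSubmodule (ι := Orb Λ) (Fintype.card Λ))).projState O).re -
        (star w ⬝ᵥ O *ᵥ w).re| ≤ 2 * h * (β + β ^ 2) := by
  rw [← sectorGroundProj_szSector_eq hG A hA hcard ht hU]
  exact TempleKato.sector_expectation_enclosure (LiebThm1.hamiltonian_isHermitian G t U) _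
    (fun v hv => hamiltonian_mulVec_mem_szSector G t U hv) hW hWK hwK hw1 hρ hr2 hρσ hOform hβ hβr

end LiebHalfFilled

/-! ### A computational substitute for Lieb's theorem: certified spin gaps

No bipartiteness, any `t`, `U`, any even particle number `N = 2n`: if NO ground-energy
eigenvector has `S^z = ±1` (e.g. because the sector energies `λ_min(n ± 1, n ∓ 1)` are certified to
lie strictly above a certified upper bound for `E₀(2n)`), then every `2n`-particle ground state has
`S^z = 0` — by the `su(2)` ladder: a weight-`m` component, `m ≥ 1`, of a ground state is mapped by
`(S⁻)^{m-1}` injectively to a weight-`1` ground state. With a simplicity certificate in the central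
sector this identifies THE `2n`-particle ground state exactly as Lieb's theorem does at half
filling. -/

namespace SpinGapCertificate

variable {Λ : Type*} [LinearOrder Λ] [Fintype Λ] (G : SimpleGraph Λ) [DecidableRel G.Adj]

/-- **Ground states have `S^z = 0` when no ground-energy eigenvector has `S^z = ±1`.** For the
Hubbard Hamiltonian on ANY finite graph, any `t`, `U` and `N = 2n`: if the joint sectors
`(2n, S^z = 1)` and `(2n, S^z = -1)` contain no eigenvector with eigenvalue `E₀(2n)`, then the
`2n`-particle ground multiplet lies in `szSector (2n) 0`. (Angular-momentum ladder; Tasaki (2020)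
§2.4, App. A.3.) [folklore] -/
theorem groundSector_le_szSector_of_noWeightOne (t U : ℝ) (n : ℕ)
    (hup : ∀ φ ∈ szSector (2 * n) 1,
      hamiltonian G t U *ᵥ φ = ((groundEnergyAt G t U (2 * n) : ℝ) : ℂ) • φ → φ = 0)
    (hdn : ∀ φ ∈ szSector (2 * n) (-1),
      hamiltonian G t U *ᵥ φ = ((groundEnergyAt G t U (2 * n) : ℝ) : ℂ) • φ → φ = 0) :
    (hamiltonian G t U).sectorGroundSpace (nParticleSubmodule (ι := Orb Λ) (2 * n)) ≤
      szSector (2 * n) 0 := by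
  classical
  set H := hamiltonian G t U with hH
  set N := 2 * n with hN
  set E₀ : ℝ := groundEnergyAt G t U N with hE₀
  set V := H.sectorGroundSpace (nParticleSubmodule (ι := Orb Λ) N) with hV
  have hsu := LiebTwo.isSu2Triple_spin (Λ := Λ)
  -- `V` is stable under `S^±`
  have hmemV : ∀ φ, φ ∈ V ↔ IsNParticle N φ ∧ H *ᵥ φ = (E₀ : ℂ) • φ :=
    fun φ => LiebHalfFilled.mem_groundSector_iff G t U N φ
  have hPV : ∀ φ ∈ V, spinPlus *ᵥ φ ∈ V := by
    intro φ hφ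
    rw [hmemV] at hφ ⊢
    refine ⟨LiebTwo.isNParticle_mulVec_of_commute hφ.1 LiebTwo.totalNumber_mul_spinPlus, ?_⟩
    rw [mulVec_mulVec, hH, (LiebThm1.hamiltonian_commute_spinPlus G t U).eq, ← mulVec_mulVec, ← hH,
      hφ.2, mulVec_smul]
  have hMV : ∀ φ ∈ V, spinMinus *ᵥ φ ∈ V := by
    intro φ hφ
    rw [hmemV] at hφ ⊢
    refine ⟨LiebTwo.isNParticle_mulVec_of_commute hφ.1 LiebTwo.totalNumber_mul_spinMinus, ?_⟩
    rw [mulVec_mulVec, hH, (LiebThm1.hamiltonian_commute_spinMinus G t U).eq, ← mulVec_mulVec, ← hH,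
      hφ.2, mulVec_smul]
  -- a weight-`±(k+1)` vector of `V` vanishes
  have hpos : ∀ (k : ℕ) (v : Fock (Orb Λ)), v ∈ V →
      HubbardWave0.spinZ *ᵥ v = (((k + 1 : ℕ) : ℤ) : ℂ) • v → v = 0 := by
    intro k v hvV hvZ
    rw [Int.cast_natCast] at hvZ
    by_contra hv0
    set u := spinMinus ^ k *ᵥ v with hu
    have huV : u ∈ V := IsSu2Triple.pow_mulVec_mem hMV k hvV
    have huZ : HubbardWave0.spinZ *ᵥ u = (1 : ℂ) • u := by
      rw [hu, hsu.weight_M_pow hvZ k]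
      congr 1
      push_cast; ring
    have hu0 : u ≠ 0 := fun h0 =>
      hv0 (hsu.eq_zero_of_M_pow_eq_zero k (m := k + 1) (by omega) (by exact_mod_cast hvZ) h0)
    obtain ⟨huN, hHu⟩ := (hmemV u).1 huV
    have huK : u ∈ szSector N 1 := by
      rw [mem_szSector_iff]
      exact ⟨huN, by rw [Complex.ofReal_one]; exact huZ⟩
    exact hu0 (hup u huK hHu)
  have hneg : ∀ (k : ℕ) (v : Fock (Orb Λ)), v ∈ V →
      HubbardWave0.spinZ *ᵥ v = ((-((k + 1 : ℕ) : ℤ) : ℤ) : ℂ) • v → v = 0 := by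
    intro k v hvV hvZ
    have hsu' := hsu.mirror
    have hvZ' : (-HubbardWave0.spinZ) *ᵥ v = (((k + 1 : ℕ) : ℂ)) • v := by
      rw [neg_mulVec, hvZ, Int.cast_neg, Int.cast_natCast, neg_smul, neg_neg]
    by_contra hv0
    set u := spinPlus ^ k *ᵥ v with hu
    have huV : u ∈ V := IsSu2Triple.pow_mulVec_mem hPV k hvV
    have huZ' : (-HubbardWave0.spinZ) *ᵥ u = (1 : ℂ) • u := by
      rw [hu, hsu'.weight_M_pow hvZ' k]
      congr 1
      push_cast; ring
    have huZ : HubbardWave0.spinZ *ᵥ u = (((-1 : ℝ) : ℝ) : ℂ) • u := by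
      rw [neg_mulVec, one_smul] at huZ'
      rw [← neg_neg (HubbardWave0.spinZ *ᵥ u), huZ']
      push_cast
      rw [neg_one_smul]
    have hu0 : u ≠ 0 := fun h0 =>
      hv0 (hsu'.eq_zero_of_M_pow_eq_zero k (m := k + 1) (by omega) (by exact_mod_cast hvZ') h0)
    obtain ⟨huN, hHu⟩ := (hmemV u).1 huV
    have huK : u ∈ szSector N (-1) := (mem_szSector_iff _ _ _).2 ⟨huN, huZ⟩
    exact hu0 (hdn u huK hHu)
  -- weight decomposition of a ground state
  intro ψ hψ
  obtain ⟨hNψ, hHψ⟩ := (hmemV ψ).1 hψ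
  obtain ⟨S, w, hw, hsum⟩ := LiebTwo.groundSector_weight_decomposition G t U n E₀ ⟨hHψ, hNψ⟩
  have hwm : ∀ m ∈ S, (m : ℂ) • w m = 0 := by
    intro m hm
    obtain ⟨⟨hHw, hNw⟩, hZw⟩ := hw m hm
    have hwV : w m ∈ V := (hmemV _).2 ⟨hNw, hHw⟩
    rcases Int.eq_nat_or_neg m with ⟨k, rfl | rfl⟩
    · cases k with
      | zero => rw [Nat.cast_zero, Int.cast_zero, zero_smul]
      | succ k => rw [hpos k (w _) hwV hZw, smul_zero]
    · cases k with
      | zero => rw [Nat.cast_zero, neg_zero, Int.cast_zero, zero_smul]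
      | succ k => rw [hneg k (w _) hwV hZw, smul_zero]
  have hZψ : HubbardWave0.spinZ *ᵥ ψ = 0 := by
    rw [hsum, mulVec_sum]
    refine Finset.sum_eq_zero fun m hm => ?_
    rw [(hw m hm).2]
    exact hwm m hm
  rw [mem_szSector_iff]
  exact ⟨hNψ, by rw [hZψ, Complex.ofReal_zero, zero_smul]⟩

/-- **Strict sector inequalities suffice**: if `E₀(2n) < λ_min(2n, S^z = 1)` and
`E₀(2n) < λ_min(2n, S^z = -1)` then no ground-energy eigenvector has weight `±1`, so the
`2n`-particle ground multiplet lies in `szSector (2n) 0`. [folklore] -/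
theorem groundSector_le_szSector_of_spinGap (t U : ℝ) (n : ℕ)
    (hup : groundEnergyAt G t U (2 * n) < (hamiltonian G t U).minEnergyOn (szSector (2 * n) 1))
    (hdn : groundEnergyAt G t U (2 * n) < (hamiltonian G t U).minEnergyOn (szSector (2 * n) (-1))) :
    (hamiltonian G t U).sectorGroundSpace (nParticleSubmodule (ι := Orb Λ) (2 * n)) ≤
      szSector (2 * n) 0 := by
  have hHerm := LiebThm1.hamiltonian_isHermitian G t U
  have key : ∀ (M : ℝ), groundEnergyAt G t U (2 * n) < (hamiltonian G t U).minEnergyOn (szSector (2 * n) M) →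
      ∀ φ ∈ szSector (2 * n) M,
        hamiltonian G t U *ᵥ φ = ((groundEnergyAt G t U (2 * n) : ℝ) : ℂ) • φ → φ = 0 := by
    intro M hlt φ hφ hHφ
    by_contra h0
    have hpos := RayleighBottom.re_star_dotProduct_self_pos h0
    have h := minEnergyOn_mul_le_re_rayleigh hHerm (szSector (2 * n) M) hφ
    rw [hHφ, dotProduct_smul, smul_eq_mul, Complex.re_ofReal_mul] at h
    have := lt_of_le_of_lt h (mul_lt_mul_of_pos_right hlt hpos)
    exact lt_irrefl _ this
  exact groundSector_le_szSector_of_noWeightOne G t U n (key 1 hup) (key (-1) hdn)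

/-- **Form bounds suffice** (the shape a PSD block certificate delivers,
`Hubbard.mul_normSq_le_of_sectorBlock_posSemidef`): if `Re ⟨φ, H φ⟩ ≥ σ ‖φ‖²` on the sectors
`S^z = ±1` with `E₀(2n) < σ` (e.g. `E₀(2n) ≤ ρ < σ` from a trial vector), then the `2n`-particle
ground multiplet lies in `szSector (2n) 0`. [folklore] -/
theorem groundSector_le_szSector_of_form_bounds (t U : ℝ) (n : ℕ) {σup σdn : ℝ}
    (hup : ∀ φ ∈ szSector (2 * n) 1, σup * (star φ ⬝ᵥ φ).re ≤ (star φ ⬝ᵥ hamiltonian G t U *ᵥ φ).re)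
    (hdn : ∀ φ ∈ szSector (2 * n) (-1), σdn * (star φ ⬝ᵥ φ).re ≤ (star φ ⬝ᵥ hamiltonian G t U *ᵥ φ).re)
    (hσup : groundEnergyAt G t U (2 * n) < σup) (hσdn : groundEnergyAt G t U (2 * n) < σdn) :
    (hamiltonian G t U).sectorGroundSpace (nParticleSubmodule (ι := Orb Λ) (2 * n)) ≤
      szSector (2 * n) 0 := by
  have key : ∀ (M σ : ℝ), groundEnergyAt G t U (2 * n) < σ →
      (∀ φ ∈ szSector (2 * n) M, σ * (star φ ⬝ᵥ φ).re ≤ (star φ ⬝ᵥ hamiltonian G t U *ᵥ φ).re) →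
      ∀ φ ∈ szSector (2 * n) M,
        hamiltonian G t U *ᵥ φ = ((groundEnergyAt G t U (2 * n) : ℝ) : ℂ) • φ → φ = 0 := by
    intro M σ hlt hform φ hφ hHφ
    by_contra h0
    have hpos := RayleighBottom.re_star_dotProduct_self_pos h0
    have h := hform φ hφ
    rw [hHφ, dotProduct_smul, smul_eq_mul, Complex.re_ofReal_mul] at h
    have := lt_of_le_of_lt h (mul_lt_mul_of_pos_right hlt hpos)
    exact lt_irrefl _ this
  exact groundSector_le_szSector_of_noWeightOne G t U n (key 1 σup hσup hup) (key (-1) σdn hσdn hdn)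

/-- **The central sector's ground multiplet IS the `2n`-particle ground multiplet** whenever the
latter lies in `S^z = 0` (any graph, `t`, `U`; `n ≤ |Λ|`). [folklore] -/
theorem sectorGroundSpace_szSector_eq_of_le (t U : ℝ) {n : ℕ} (hn : n ≤ Fintype.card Λ)
    (hle : (hamiltonian G t U).sectorGroundSpace (nParticleSubmodule (ι := Orb Λ) (2 * n)) ≤
      szSector (2 * n) 0) :
    (hamiltonian G t U).sectorGroundSpace (szSector (2 * n) 0) =
      (hamiltonian G t U).sectorGroundSpace (nParticleSubmodule (ι := Orb Λ) (2 * n)) := by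
  refine le_antisymm (LiebHalfFilled.sectorGroundSpace_szSector_le G t U hn) fun φ hφ => ?_
  rw [Matrix.mem_sectorGroundSpace_iff, ← groundEnergyAt_eq_minEnergyOn_szSector G t U hn]
  exact ⟨hle hφ, ((LiebHalfFilled.mem_groundSector_iff G t U _ φ).1 hφ).2⟩

/-- **Sector certificate + spin-gap certificate ⇒ THE ground state** (no bipartiteness, any
`t`, `U`, `N = 2n ≤ 2|Λ|`). Given (i) a Kato–Temple gap certificate `(W, u)`, threshold `σ`, and a
unit trial vector `w` (`Re ⟨w, H w⟩ = ρ < σ`, `‖H w‖² ≤ r² + ρ²`) in the central sector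
`K = szSector (2n) 0`, and (ii) form bounds `Re ⟨φ, H φ⟩ ≥ σ± ‖φ‖²` on the sectors `S^z = ±1` with
`ρ < σ±`: the `2n`-particle ground state is unique — a unit vector `ψ ∈ K` with
`H ψ = E₀(2n) ψ`, every `2n`-particle ground state equal to `⟨ψ, φ⟩ ψ`, tracial `2n`-particle
ground state `O ↦ ⟨ψ, O ψ⟩` — and `ρ - r²/(σ - ρ) ≤ E₀(2n) ≤ ρ`, `(1 - |⟨ψ, w⟩|²)(σ - ρ)² ≤ r²`;
moreover for an observable with `|⟨x, (O - m) x⟩| ≤ h ‖x‖²` and `r² ≤ β²(σ - ρ)²`, `β ≥ 0`: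
`|Re ω₀(O) - Re ⟨w, O w⟩| ≤ 2 h (β + β²)`. Saad (1992) Thms 3.8–3.9; Tasaki (2020) §2.4.
[folklore] -/
theorem groundState_certificate (t U : ℝ) {n : ℕ} (hn : n ≤ Fintype.card Λ)
    {W : Submodule ℂ (Fock (Orb Λ))} {u : Fock (Orb Λ)} {σ : ℝ}
    (hW : ∀ z ∈ W, σ * (star z ⬝ᵥ z).re ≤ (star z ⬝ᵥ hamiltonian G t U *ᵥ z).re)
    (hWK : ∀ x ∈ szSector (2 * n) 0, ∃ z ∈ W, ∃ c : ℂ, x = z + c • u)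
    {w : Fock (Orb Λ)} (hwK : w ∈ szSector (2 * n) 0) (hw1 : star w ⬝ᵥ w = 1)
    {ρ r2 : ℝ} (hρ : (star w ⬝ᵥ hamiltonian G t U *ᵥ w).re = ρ)
    (hr2 : (star (hamiltonian G t U *ᵥ w) ⬝ᵥ hamiltonian G t U *ᵥ w).re ≤ r2 + ρ ^ 2)
    (hρσ : ρ < σ) {σup σdn : ℝ}
    (hup : ∀ φ ∈ szSector (2 * n) 1, σup * (star φ ⬝ᵥ φ).re ≤ (star φ ⬝ᵥ hamiltonian G t U *ᵥ φ).re)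
    (hdn : ∀ φ ∈ szSector (2 * n) (-1), σdn * (star φ ⬝ᵥ φ).re ≤ (star φ ⬝ᵥ hamiltonian G t U *ᵥ φ).re)
    (hρup : ρ < σup) (hρdn : ρ < σdn) :
    ρ - r2 / (σ - ρ) ≤ groundEnergyAt G t U (2 * n) ∧ groundEnergyAt G t U (2 * n) ≤ ρ ∧
      ∃ ψ ∈ szSector (2 * n) 0, star ψ ⬝ᵥ ψ = 1 ∧
        hamiltonian G t U *ᵥ ψ = ((groundEnergyAt G t U (2 * n) : ℝ) : ℂ) • ψ ∧
        (∀ φ : Fock (Orb Λ), IsNParticle (2 * n) φ →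
          hamiltonian G t U *ᵥ φ = ((groundEnergyAt G t U (2 * n) : ℝ) : ℂ) • φ →
            φ = (star ψ ⬝ᵥ φ) • ψ) ∧
        (∀ O : Matrix (Finset (Orb Λ)) (Finset (Orb Λ)) ℂ,
          ((hamiltonian G t U).sectorGroundProj
              (nParticleSubmodule (ι := Orb Λ) (2 * n))).projState O = star ψ ⬝ᵥ O *ᵥ ψ) ∧
        (1 - ‖star ψ ⬝ᵥ w‖ ^ 2) * (σ - ρ) ^ 2 ≤ r2 ∧
        ∀ {O : Matrix (Finset (Orb Λ)) (Finset (Orb Λ)) ℂ} {m h β : ℝ},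
          (∀ x : Fock (Orb Λ), ‖star x ⬝ᵥ O *ᵥ x - (m : ℂ) * (star x ⬝ᵥ x)‖ ≤ h * (star x ⬝ᵥ x).re) →
          0 ≤ β → r2 ≤ β ^ 2 * (σ - ρ) ^ 2 →
          |(((hamiltonian G t U).sectorGroundProj
              (nParticleSubmodule (ι := Orb Λ) (2 * n))).projState O).re -
              (star w ⬝ᵥ O *ᵥ w).re| ≤ 2 * h * (β + β ^ 2) := by
  set H := hamiltonian G t U with hH
  have hHerm : H.IsHermitian := LiebThm1.hamiltonian_isHermitian G t U
  have hE : groundEnergyAt G t U (2 * n) = H.minEnergyOn (szSector (2 * n) 0) :=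
    groundEnergyAt_eq_minEnergyOn_szSector G t U hn
  have hKA : ∀ v ∈ szSector (2 * n) (0 : ℝ), H *ᵥ v ∈ szSector (2 * n) 0 :=
    fun v hv => LiebHalfFilled.hamiltonian_mulVec_mem_szSector G t U hv
  obtain ⟨h1, h2, ψ, hψK, hψ1, hHψ, huniq, -, hsin⟩ :=
    TempleKato.sector_enclosure hHerm (szSector (2 * n) 0) hKA hW hWK hwK hw1 hρ hr2 hρσ
  obtain ⟨-, hstate⟩ := TempleKato.projState_sectorGroundProj_eq (szSector (2 * n) 0) hψK hψ1 hHψ huniq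
  rw [← hE] at h1 h2 hHψ huniq
  -- the spin-gap certificate puts every ground state into the central sector
  have hle : H.sectorGroundSpace (nParticleSubmodule (ι := Orb Λ) (2 * n)) ≤ szSector (2 * n) 0 :=
    groundSector_le_szSector_of_form_bounds G t U n hup hdn (h2.trans_lt hρup) (h2.trans_lt hρdn)
  have hproj : H.sectorGroundProj (szSector (2 * n) 0) =
      H.sectorGroundProj (nParticleSubmodule (ι := Orb Λ) (2 * n)) := by
    unfold Matrix.sectorGroundProj
    rw [sectorGroundSpace_szSector_eq_of_le G t U hn hle]
  rw [hproj] at hstate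
  refine ⟨h1, h2, ψ, hψK, hψ1, hHψ, fun φ hφN hHφ => ?_, hstate, hsin, ?_⟩
  · have hφV : φ ∈ H.sectorGroundSpace (nParticleSubmodule (ι := Orb Λ) (2 * n)) :=
      (LiebHalfFilled.mem_groundSector_iff G t U _ φ).2 ⟨hφN, hHφ⟩
    exact huniq φ (hle hφV) hHφ
  · intro O m h β hOform hβ hβr
    rw [← hproj]
    exact TempleKato.sector_expectation_enclosure hHerm _ hKA hW hWK hwK hw1 hρ hr2 hρσ hOform hβ hβr

end SpinGapCertificate

end Literature.MathematicalPhysics.QuantumLattice
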